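import Literature.NumberTheory.EllipticCurves.IwasawaAlgebraProofs
import Summits.BirchSwinnertonDyer.Rank1Residual.X1.MuLambdaAlgebra
import Mathlib.LinearAlgebra.Matrix.Charpoly.LinearMap
import Mathlib.NumberTheory.Padics.RingHoms
import HarnessLib

/-!
# `Λ`-algebra for the crux `SignedTransportAtTwo` (stmt-BirchSwinnertonDyer-20333, route `ThetaPartnerAtTwo`, line
# `bridge`): FINITENESS OF `X/pX` ⟺ `X` IS `Λ`-TORSION WITH `μ(X) = 0` (for finitely generated `X`)
# (lead prover bsd-wall-tp2-p1 g2; `--supports stmt-BirchSwinnertonDyer-20333`; route-independent, closes nothing)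

HONEST FRAMING. Pure algebra in `Λ = ℤ_p⟦T⟧` for ANY prime `p`; nothing about any curve is asserted.

WHAT IS PROVED, AND WHY. Greenberg–Vatsal (Invent. Math. 142 (2000), proof of Thm. (1.4), p. 3 and §2) and B. D. Kim
(Asian J. Math. 13 (2009), Cor. 2.13) transport "`X` is `Λ`-torsion with `μ = 0`" from one member of a congruence
`E[p] ≅ E′[p]` to the other THROUGH THE RESIDUAL SELMER GROUP: `Sel(E/ℚ_∞)[p]` is finite iff `X = Sel^∨` is
`Λ`-torsion with `μ(X) = 0`, and `Sel[p]` (Pontryagin dual `X/pX`) is, up to finite groups, determined by `E[p]`. This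
file is the `⟺` as kernel-checked `Λ`-algebra for a finitely generated `Λ`-module `M`:
* §1 `isTorsion_and_muInvariant_eq_zero_of_finite_quotient`: `M/pM` finite ⇒ `M` is `Λ`-torsion AND `μ(M) = 0`
  (pigeonhole: `T^a·m ∈ pM`; Cayley–Hamilton (Matsumura 2.1) for `T^N` with `T^N M ⊆ pM` gives a monic relation
  `d = T^{Ns} + (p-multiples)`, `d·M = 0`, `d ≢ 0 (mod p)`; hence `M_{(p)} = 0`, i.e. `μ = length_{(p)} = 0`, and `d ≠ 0`);
* §2 `finite_quotient_of_muInvariant_eq_zero`: `M` torsion with `μ(M) = 0` ⇒ `M/pM` finite (`μ = 0` ⟺ f.g. over `ℤ_p`,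
  tree theorem `muInvariant_eq_zero_iff_finite`; then `M/pM` is a quotient of `𝔽_p^n`).
Used at `p = 2` by `Theorems/ThetaPartnerAtTwoSignedTransportAtTwoBridgeResidual.lean` to drive the algebraic `μ`/torsion
stub of the crux down to the finiteness of the residual signed Selmer dual — the statement Greenberg–Vatsal actually
transport. In particular TORSION of `X⁺(W)` at `2` is an OUTPUT of that finiteness (no separate Kobayashi-1.2-at-2 input).
No sorry; standard axioms.

References: [GreenbergVatsal2000] p. 3 (proof of Thm. (1.4)), §2 Prop. (2.8)–(2.10); [BDKim2009] Cor. 2.13;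
[Washington1997] §13.2; [Matsumura1986] Thm. 2.1.
-/

set_option autoImplicit false
-- D-0017: single-problem summit, so `Summit.BirchSwinnertonDyer.BirchSwinnertonDyer.…` repeats a namespace BY DESIGN.
set_option linter.dupNamespace false

noncomputable section

open scoped Classical

open Polynomial Literature.NumberTheory.EllipticCurves Literature.NumberTheory.EllipticCurves.IwasawaAlgebra
  Summit.BirchSwinnertonDyer.Rank1Residual.X1.MuLambda

namespace Summit.BirchSwinnertonDyer.BirchSwinnertonDyer.Theorems.SignedTransportAtTwo

variable {p : ℕ} [hp : Fact p.Prime] {M : Type*} [AddCommGroup M] [Module (IwasawaAlgebra p) M]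

/-! ## §1. `M/pM` finite ⇒ `M` is `Λ`-torsion with `μ(M) = 0` -/

/-- `1 − T^k` is a unit of `Λ` for `k ≥ 1` (constant coefficient `1`). [cite: Washington1997, §7.1] -/
theorem isUnit_one_sub_X_pow {k : ℕ} (hk : 1 ≤ k) : IsUnit (1 - (PowerSeries.X : IwasawaAlgebra p) ^ k) := by
  rw [PowerSeries.isUnit_iff_constantCoeff, map_sub, map_one, map_pow, PowerSeries.constantCoeff_X,
    zero_pow (by omega), sub_zero]
  exact isUnit_one

/-- Pigeonhole: if `M/pM` is finite then every `m ∈ M` has `T^a · m ∈ pM` for some `a`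
(two of the `T^n·m` agree mod `pM`, and `1 − T^k` is a unit). [cite: GreenbergVatsal2000, §2 (p. 3, proof of Thm. (1.4))] -/
theorem exists_X_pow_smul_mem_of_finite_quotient
    (hfin : Finite (M ⧸ (augIdealP p • ⊤ : Submodule (IwasawaAlgebra p) M))) (m : M) :
    ∃ a : ℕ, (PowerSeries.X : IwasawaAlgebra p) ^ a • m ∈ (augIdealP p • ⊤ : Submodule (IwasawaAlgebra p) M) := by
  set N := (augIdealP p • ⊤ : Submodule (IwasawaAlgebra p) M) with hN
  obtain ⟨a, b, hab, heq⟩ := Finite.exists_ne_map_eq_of_infinite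
    (fun n : ℕ => Submodule.Quotient.mk (p := N) ((PowerSeries.X : IwasawaAlgebra p) ^ n • m))
  -- from `T^a m ≡ T^b m (mod N)` with `a < b`: `(1 − T^{b−a}) T^a m ∈ N`
  have key : ∀ {a b : ℕ}, a < b →
      Submodule.Quotient.mk (p := N) ((PowerSeries.X : IwasawaAlgebra p) ^ a • m) =
        Submodule.Quotient.mk (p := N) ((PowerSeries.X : IwasawaAlgebra p) ^ b • m) →
      ∃ c : ℕ, (PowerSeries.X : IwasawaAlgebra p) ^ c • m ∈ N := by
    intro a b hlt h
    have hmem : (1 - (PowerSeries.X : IwasawaAlgebra p) ^ (b - a)) • ((PowerSeries.X : IwasawaAlgebra p) ^ a • m) ∈ N := by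
      rw [sub_smul, one_smul, ← mul_smul, ← pow_add, Nat.sub_add_cancel hlt.le]
      exact (Submodule.Quotient.eq N).mp h
    obtain ⟨u, hu⟩ := isUnit_one_sub_X_pow (p := p) (k := b - a) (by omega)
    refine ⟨a, ?_⟩
    have := N.smul_mem (↑u⁻¹ : IwasawaAlgebra p) hmem
    rwa [← hu, ← mul_smul, Units.inv_mul, one_smul] at this
  rcases lt_or_gt_of_ne hab with h | h
  · exact key h heq
  · exact key h heq.symm

/-- **`M/pM` finite ⇒ `M` is `Λ`-torsion with `μ(M) = 0`**, for a finitely generated `Λ`-module `M` — the `Λ`-algebra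
behind Greenberg–Vatsal's "if `Sel(E/ℚ_∞)[p]` is finite then `Sel(E/ℚ_∞)_p` is `Λ`-cotorsion with `μ = 0`" (p. 3) and
B. D. Kim's Cor. 2.13: a uniform `N` with `T^N M ⊆ pM`, Cayley–Hamilton for `T^N` (Matsumura Thm. 2.1) gives a monic
relation `d·M = 0` with `d ≡ T^{Ns} (mod p)`, so `d ≠ 0` (torsion) and `d ∉ (p)`, i.e. `M_{(p)} = 0`, `μ(M) = 0`.
[cite: GreenbergVatsal2000, p. 3 (proof of Thm. (1.4))] [cite: BDKim2009, Cor. 2.13] [cite: Washington1997, §13.2] -/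
theorem isTorsion_and_muInvariant_eq_zero_of_finite_quotient [Module.Finite (IwasawaAlgebra p) M]
    (hfin : Finite (M ⧸ (augIdealP p • ⊤ : Submodule (IwasawaAlgebra p) M))) :
    Module.IsTorsion (IwasawaAlgebra p) M ∧ muInvariant p M = 0 := by
  set I : Ideal (IwasawaAlgebra p) := augIdealP p with hI
  set N := (I • ⊤ : Submodule (IwasawaAlgebra p) M) with hN
  -- a uniform exponent: `T^K · M ⊆ pM`
  obtain ⟨S, hS⟩ := Module.Finite.fg_top (R := IwasawaAlgebra p) (M := M)
  choose a ha using fun m : M => exists_X_pow_smul_mem_of_finite_quotient hfin m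
  set K : ℕ := S.sup a with hK
  have hKmem : ∀ m : M, (PowerSeries.X : IwasawaAlgebra p) ^ K • m ∈ N := by
    intro m
    have hm : m ∈ Submodule.span (IwasawaAlgebra p) (S : Set M) := by rw [hS]; trivial
    induction hm using Submodule.span_induction with
    | mem x hx =>
      have hle : a x ≤ K := Finset.le_sup (f := a) hx
      rw [← Nat.sub_add_cancel hle, pow_add, mul_smul]
      exact N.smul_mem _ (ha x)
    | zero => rw [smul_zero]; exact N.zero_mem
    | add x y _ _ hx hy => rw [smul_add]; exact N.add_mem hx hy
    | smul c x _ hx => rw [smul_comm]; exact N.smul_mem c hx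
  -- Cayley–Hamilton for the endomorphism `T^K`
  set f : Module.End (IwasawaAlgebra p) M :=
    Algebra.lsmul (IwasawaAlgebra p) (IwasawaAlgebra p) M ((PowerSeries.X : IwasawaAlgebra p) ^ K) with hf
  have hrange : LinearMap.range f ≤ I • ⊤ := by
    rintro _ ⟨m, rfl⟩
    exact hKmem m
  obtain ⟨q, hmonic, -, hcoeff, hq⟩ :=
    LinearMap.exists_monic_and_natDegree_eq_and_coeff_mem_pow_and_aeval_eq_zero (IwasawaAlgebra p) f I hrange
  set d : IwasawaAlgebra p := Polynomial.aeval ((PowerSeries.X : IwasawaAlgebra p) ^ K) q with hd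
  have hdM : Module.IsTorsionBy (IwasawaAlgebra p) M d := by
    intro m
    have := LinearMap.congr_fun hq m
    rwa [hf, Polynomial.aeval_algHom_apply, LinearMap.zero_apply, Algebra.lsmul_coe] at this
  -- `d ≡ T^{K·deg q} (mod p)`: the lower coefficients lie in `I = (p)`
  have hred : red d = (PowerSeries.X : PowerSeries (IsLocalRing.ResidueField ℤ_[p])) ^ (K * q.natDegree) := by
    rw [hd, Polynomial.aeval_eq_sum_range, red, map_sum, Finset.sum_range_succ, Finset.sum_eq_zero, zero_add,
      hmonic.coeff_natDegree, one_smul, map_pow, map_pow, PowerSeries.map_X, ← pow_mul]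
    intro k hk
    rw [Finset.mem_range] at hk
    have hmem : q.coeff k ∈ I := Ideal.pow_le_self (by omega) (hcoeff k)
    rw [smul_eq_mul, map_mul, ← red, (red_eq_zero_iff _).mpr (Ideal.mem_span_singleton.mp hmem), zero_mul]
  have hredne : red d ≠ 0 := by rw [hred]; exact pow_ne_zero _ PowerSeries.X_ne_zero
  have hd0 : d ≠ 0 := by rintro h0; exact hredne (by rw [h0, red, map_zero])
  have hdI : d ∉ I := by
    intro hmem
    exact hredne ((red_eq_zero_iff _).mpr (Ideal.mem_span_singleton.mp hmem))
  refine ⟨fun m => ⟨⟨d, mem_nonZeroDivisors_of_ne_zero hd0⟩, @hdM m⟩, ?_⟩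
  let 𝔭 : PrimeSpectrum (IwasawaAlgebra p) := ⟨augIdealP p, isPrime_augIdealP_holds p⟩
  rw [muInvariant_eq_toNat_lengthAt p M 𝔭 rfl, Module.lengthAt_eq_zero_of_isTorsionBy hdM 𝔭 hdI, ENat.toNat_zero]

/-! ## §2. `M` torsion with `μ(M) = 0` ⇒ `M/pM` finite -/

/-- **`M` finitely generated `Λ`-torsion with `μ(M) = 0` ⇒ `M/pM` finite**: `μ = 0` iff `M` is finitely generated over
`ℤ_p` (tree theorem `muInvariant_eq_zero_iff_finite`, Washington §13.2), and then `M/pM` is a quotient of `𝔽_p^n`.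
[cite: Washington1997, §13.2] [cite: GreenbergVatsal2000, p. 3 (proof of Thm. (1.4))] -/
theorem finite_quotient_of_muInvariant_eq_zero [Module.Finite (IwasawaAlgebra p) M]
    (hM : Module.IsTorsion (IwasawaAlgebra p) M) (hμ : muInvariant p M = 0) :
    Finite (M ⧸ (augIdealP p • ⊤ : Submodule (IwasawaAlgebra p) M)) := by
  letI : Module ℤ_[p] M := Module.compHom M (algebraMap ℤ_[p] (IwasawaAlgebra p))
  haveI : IsScalarTower ℤ_[p] (IwasawaAlgebra p) M := IsScalarTower.of_compHom ℤ_[p] _ M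
  haveI hfg : Module.Finite ℤ_[p] M := (muInvariant_eq_zero_iff_finite p M hM).mp hμ
  set N := (augIdealP p • ⊤ : Submodule (IwasawaAlgebra p) M) with hN
  obtain ⟨n, g, hg⟩ := Module.Finite.exists_fin (R := ℤ_[p]) (M := M)
  -- the surjection `𝔽_p^n → M/pM`, `c ↦ Σ (lift cᵢ) • gᵢ`
  refine Finite.of_surjective
    (fun c : Fin n → ZMod p => Submodule.Quotient.mk (p := N) (∑ i, ((c i).cast : ℤ_[p]) • g i)) ?_
  intro x
  induction x using Submodule.Quotient.induction_on with
  | H m =>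
    have hm : m ∈ Submodule.span ℤ_[p] (Set.range g) := by rw [hg]; trivial
    obtain ⟨b, hb⟩ := (Submodule.mem_span_range_iff_exists_fun ℤ_[p]).mp hm
    refine ⟨fun i => PadicInt.toZMod (b i), ?_⟩
    simp only
    rw [← hb, Submodule.Quotient.eq, ← Finset.sum_sub_distrib]
    refine N.sum_mem fun i _ => ?_
    rw [← sub_smul]
    -- `lift (toZMod bᵢ) − bᵢ ∈ ker toZMod = (p)`
    have hker : ((PadicInt.toZMod (b i)).cast : ℤ_[p]) - b i ∈ Ideal.span {(p : ℤ_[p])} := by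
      rw [← PadicInt.maximalIdeal_eq_span_p, ← PadicInt.ker_toZMod, RingHom.mem_ker, map_sub,
        ZMod.ringHom_map_cast, sub_self]
    obtain ⟨c, hc⟩ := Ideal.mem_span_singleton.mp hker
    have halg : (algebraMap ℤ_[p] (IwasawaAlgebra p)) (p : ℤ_[p]) = PowerSeries.C (p : ℤ_[p]) := rfl
    rw [hc, mul_comm, mul_smul, ← algebraMap_smul (IwasawaAlgebra p) (p : ℤ_[p]), halg]
    exact N.smul_of_tower_mem c (Submodule.smul_mem_smul (Ideal.mem_span_singleton_self _) Submodule.mem_top)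

end Summit.BirchSwinnertonDyer.BirchSwinnertonDyer.Theorems.SignedTransportAtTwo

end
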